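import Mathlib.Algebra.MvPolynomial.Monad
import Mathlib.Data.Fin.VecNotation
import Mathlib.RingTheory.Ideal.Operations
import HarnessLib

/-!
# [OURS · L1 W4.5(b) · EL♮(3)] Specimen N10 — the DEEP FIBRE TOWER over `(0:0:1)`: chart identities of P · CAR · Bl φ′ · Bl Z₆ · Bl Z₇ · Bl Z₈ (kill side, res-L1-w45b-lead-1
# POST-P6-CENSUS v1.7 §5i «next frontier»; crux `EquisingularLiftNatThree`, stmt-ResolutionOfSingularities-20148)

NOT a statement of any manuscript; OURS kernel specimen (cell `res-hironaka`, chain w45b, seat res-L1-w45b-lead-1 g17).  AI-written, weaker than expert review.  Nothing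
of [Hironaka2017] is asserted; EL♮(3) is NOT proved here; NOTHING about typed cuts or about the self-intersection bookkeeping of §5i is proved here — this file certifies only the
chart algebra behind the by-hand claim «for the tail monomial z¹⁰ the fibre φ′ of E₁ over (0:0:1) carries a transversal A₇: two sections ON St E₁ (fibre pairs), then two sections
Z₇, Z₈ OFF St E₁ and ON the approximate-root surface St W only (hosted rounds)».

THE OBJECT.  `N10 = V(f)`, `f = (x² + y²z)² + x⁵ + z¹⁰ + xy⁹ + x¹² + y¹² + z¹²`.  Chart conventions (atlas7): `P` chart `S.z` is `x = X₀X₂, y = X₁X₂, z = X₂`; `CAR` chart `E1.x` of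
`S.z` is `X₂ ↦ X₂X₀` (so `E₁ = V(X₀)`, `St S = V(X₂)`, `σ_S = V(X₀, X₂)`, `φ′ = V(X₀, X₁)` with parameter `X₂ = z′`, `P′ = φ′ ∩ σ_S` at `z′ = 0`); the approximate root is
`W = X₀ + X₁²X₂`; the `X₁`-chart of the blow-up of an ideal `(g, X₁)` is `g ↦ g′·X₁`.  Every statement is a `ring` identity over an ARBITRARY commutative ring `R` or an explicit
ideal-membership witness:
* `total_P_Sz`, `total_CAR_SzE1x` : `f ∘ P ∘ CAR = X₂⁴ · X₀² · F₂`, `F₂ = (X₀ + X₁²X₂)² + X₀⁴X₂ + X₀⁴X₂⁶ + X₀⁵X₁⁹X₂⁶ + X₀¹⁸X₂⁸ + X₀⁶X₁¹²X₂⁸ + X₀⁶X₂⁸`; `mem_sq_phi'` : `F₂ ∈ (X₀, X₁)²`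
  (the fibre `φ′` is a singular curve of `St²H`);
* `total_phi'` (`X₀ ↦ X₀X₁`): `F₃ = (X₀ + X₁X₂)² + …`, `restrict_Ephi'` : `F₃|_{X₁=0} = X₀²` — the doubled section `Z₆ = V(X₀, X₁) = E_{φ′} ∩ St E₁` (`St E₁ = V(X₀)`): a FIBRE PAIR;
* `total_Z6` (`X₀ ↦ X₀X₁`): `F₄ = (X₀ + X₂)² + X₁⁴·(…)`, `restrict_EZ6` : `F₄|_{X₁=0} = (X₀ + X₂)²` — the doubled section **`Z₇ = V(X₁, X₀ + X₂)`**, the graph `x̄ = −z′`: it is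
  `E_{Z₆} ∩ St W` (`St W = X₀ + X₂` at this stage, `stW_Z6`) and it is **NOT on `St E₁ = V(X₀)`**: `Z₇ ∩ St E₁` is the single point `X₂ = 0` (`X2_mem_span_Z7_E1`: `X₂ ∈ (X₁, X₀+X₂, X₀)`);
  `mem_sq_Z7` : `F₄ ∈ (X₁, X₀ + X₂)²` (singular along `Z₇`) — so `Z₇`'s round is HOSTED (host `E_{Z₆}`), no pair with `E₁`;
* `total_Z7` (`X₀ ↦ X₀X₁ − X₂`): `F₅ = X₀² + X₁²·(…)`, `restrict_EZ7` : `F₅|_{X₁=0} = X₀²` — the doubled section **`Z₈ = V(X₀, X₁) ⊂ E_{Z₇}`**, again off `St E₁ = V(X₀X₁ − X₂)`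
  (`restrict_StE1_Z8` : on `Z₈` the equation of `St E₁` restricts to `−X₂`, vanishing only at `z′ = 0`); `mem_sq_Z8` : `F₅ ∈ (X₀, X₁)²`;
* `total_Z8` (`X₀ ↦ X₀X₁`): `restrict_EZ8` : `F₆|_{X₁=0} = X₀² + X₂⁵ + X₂¹⁰` — REDUCED: the tower ends after the second hosted round (a cusp point over `P′` remains as a leaf).
Measured counterpart: kit j321640 (`m7/tower/tower3.sage`: levels 0–3 singular, «through centre: E1 True, W True» at 0–1 and «E1 False, W True, M False» at 2–3).
-/

set_option linter.dupNamespace false -- mandated namespace `Summit.<Summit>.<Problem>` of this single-conjunct summit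

noncomputable section

open MvPolynomial

namespace Summit.ResolutionOfSingularities.ResolutionOfSingularities.Cruxes.EquisingularLiftNat.Sections

namespace SpecimenN10

variable (R : Type) [CommRing R]

/-! ## `P` (chart `S.z`) and `CAR` (chart `E1.x` of `S.z`) -/

/-- [OURS · L1 W4.5b] `f ∘ (P:S.z) = X₂⁴ · F₁`, `F₁ = (X₀² + X₁²X₂)² + X₀⁵X₂ + X₂⁶ + X₀X₁⁹X₂⁶ + X₀¹²X₂⁸ + X₁¹²X₂⁸ + X₂⁸`. [folklore] -/
theorem total_P_Sz :
    bind₁ (![X 0 * X 2, X 1 * X 2, X 2] : Fin 3 → MvPolynomial (Fin 3) R)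
        (((X 0 ^ 2 + X 1 ^ 2 * X 2) ^ 2 + (X 0 ^ 5 + X 2 ^ 10 + X 0 * X 1 ^ 9 + X 0 ^ 12 + X 1 ^ 12 + X 2 ^ 12)) : MvPolynomial (Fin 3) R) =
      X 2 ^ 4 * ((X 0 ^ 2 + X 1 ^ 2 * X 2) ^ 2 + X 0 ^ 5 * X 2 + X 2 ^ 6 + X 0 * X 1 ^ 9 * X 2 ^ 6 + X 0 ^ 12 * X 2 ^ 8 + X 1 ^ 12 * X 2 ^ 8 + X 2 ^ 8) := by
  simp only [map_add, map_pow, map_mul, bind₁_X_right]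
  simp only [Matrix.cons_val_zero, Matrix.cons_val_one, Matrix.cons_val_two, Matrix.tail_cons, Matrix.head_cons]
  ring

/-- [OURS · L1 W4.5b] `F₁ ∘ (CAR : X₂ ↦ X₂X₀) = X₀² · F₂`, `F₂ = (X₀ + X₁²X₂)² + X₀⁴X₂ + X₀⁴X₂⁶ + X₀⁵X₁⁹X₂⁶ + X₀¹⁸X₂⁸ + X₀⁶X₁¹²X₂⁸ + X₀⁶X₂⁸` — the square of the approximate root
`W = X₀ + X₁²X₂` plus a tail. [folklore] -/
theorem total_CAR_SzE1x :
    bind₁ (![X 0, X 1, X 2 * X 0] : Fin 3 → MvPolynomial (Fin 3) R)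
        ((X 0 ^ 2 + X 1 ^ 2 * X 2) ^ 2 + X 0 ^ 5 * X 2 + X 2 ^ 6 + X 0 * X 1 ^ 9 * X 2 ^ 6 + X 0 ^ 12 * X 2 ^ 8 + X 1 ^ 12 * X 2 ^ 8 + X 2 ^ 8 : MvPolynomial (Fin 3) R) =
      X 0 ^ 2 * ((X 0 + X 1 ^ 2 * X 2) ^ 2 + X 0 ^ 4 * X 2 + X 0 ^ 4 * X 2 ^ 6 + X 0 ^ 5 * X 1 ^ 9 * X 2 ^ 6 + X 0 ^ 18 * X 2 ^ 8 + X 0 ^ 6 * X 1 ^ 12 * X 2 ^ 8 +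
        X 0 ^ 6 * X 2 ^ 8) := by
  simp only [map_add, map_pow, map_mul, bind₁_X_right]
  simp only [Matrix.cons_val_zero, Matrix.cons_val_one, Matrix.cons_val_two, Matrix.tail_cons, Matrix.head_cons]
  ring

/-- [OURS · L1 W4.5b] `F₂ ∈ (X₀, X₁)²`: after `P · CAR` the strict transform is singular along the fibre `φ′ = V(X₀, X₁)` of `E₁ = V(X₀)` over `(0:0:1)` (the `z¹⁰` fibre). [folklore] -/
theorem mem_sq_phi' :
    ((X 0 + X 1 ^ 2 * X 2) ^ 2 + X 0 ^ 4 * X 2 + X 0 ^ 4 * X 2 ^ 6 + X 0 ^ 5 * X 1 ^ 9 * X 2 ^ 6 + X 0 ^ 18 * X 2 ^ 8 + X 0 ^ 6 * X 1 ^ 12 * X 2 ^ 8 +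
        X 0 ^ 6 * X 2 ^ 8 : MvPolynomial (Fin 3) R) ∈ (Ideal.span {X 0, X 1} : Ideal (MvPolynomial (Fin 3) R)) ^ 2 := by
  have h : ((X 0 + X 1 ^ 2 * X 2) ^ 2 + X 0 ^ 4 * X 2 + X 0 ^ 4 * X 2 ^ 6 + X 0 ^ 5 * X 1 ^ 9 * X 2 ^ 6 + X 0 ^ 18 * X 2 ^ 8 + X 0 ^ 6 * X 1 ^ 12 * X 2 ^ 8 +
        X 0 ^ 6 * X 2 ^ 8 : MvPolynomial (Fin 3) R) =
      X 0 * X 0 * (1 + X 0 ^ 2 * X 2 + X 0 ^ 2 * X 2 ^ 6 + X 0 ^ 3 * X 1 ^ 9 * X 2 ^ 6 + X 0 ^ 16 * X 2 ^ 8 + X 0 ^ 4 * X 1 ^ 12 * X 2 ^ 8 + X 0 ^ 4 * X 2 ^ 8) +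
        X 0 * X 1 * (2 * X 1 * X 2) + X 1 * X 1 * (X 1 ^ 2 * X 2 ^ 2) := by ring
  rw [h, pow_two]
  have h0 : (X 0 : MvPolynomial (Fin 3) R) ∈ Ideal.span ({X 0, X 1} : Set (MvPolynomial (Fin 3) R)) := Ideal.subset_span (by simp)
  have h1 : (X 1 : MvPolynomial (Fin 3) R) ∈ Ideal.span ({X 0, X 1} : Set (MvPolynomial (Fin 3) R)) := Ideal.subset_span (by simp)
  refine Ideal.add_mem _ (Ideal.add_mem _ ?_ ?_) ?_
  · exact Ideal.mul_mem_right _ _ (Ideal.mul_mem_mul h0 h0)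
  · exact Ideal.mul_mem_right _ _ (Ideal.mul_mem_mul h0 h1)
  · exact Ideal.mul_mem_right _ _ (Ideal.mul_mem_mul h1 h1)

/-! ## Round at `φ′` (`X₁`-chart, `X₀ ↦ X₀X₁`): the section `Z₆` lies ON `St E₁` — a fibre pair -/

/-- [OURS · L1 W4.5b] `F₂(X₀X₁, X₁, X₂) = X₁² · F₃`. [folklore] -/
theorem total_phi' :
    bind₁ (![X 0 * X 1, X 1, X 2] : Fin 3 → MvPolynomial (Fin 3) R)
        ((X 0 + X 1 ^ 2 * X 2) ^ 2 + X 0 ^ 4 * X 2 + X 0 ^ 4 * X 2 ^ 6 + X 0 ^ 5 * X 1 ^ 9 * X 2 ^ 6 + X 0 ^ 18 * X 2 ^ 8 + X 0 ^ 6 * X 1 ^ 12 * X 2 ^ 8 +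
          X 0 ^ 6 * X 2 ^ 8 : MvPolynomial (Fin 3) R) =
      X 1 ^ 2 * ((X 0 + X 1 * X 2) ^ 2 + X 0 ^ 4 * X 1 ^ 2 * X 2 + X 0 ^ 4 * X 1 ^ 2 * X 2 ^ 6 + X 0 ^ 5 * X 1 ^ 12 * X 2 ^ 6 + X 0 ^ 18 * X 1 ^ 16 * X 2 ^ 8 +
        X 0 ^ 6 * X 1 ^ 16 * X 2 ^ 8 + X 0 ^ 6 * X 1 ^ 4 * X 2 ^ 8) := by
  simp only [map_add, map_pow, map_mul, bind₁_X_right]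
  simp only [Matrix.cons_val_zero, Matrix.cons_val_one, Matrix.cons_val_two, Matrix.tail_cons, Matrix.head_cons]
  ring

/-- [OURS · L1 W4.5b] `F₃|_{E_{φ′}} = X₀²`: the strict transform meets `E_{φ′} = V(X₁)` in the DOUBLED section `Z₆ = V(X₀, X₁) = E_{φ′} ∩ St E₁` — presented by the pair
`(E₁, E_{φ′})`. [folklore] -/
theorem restrict_Ephi' :
    bind₁ (![X 0, 0, X 2] : Fin 3 → MvPolynomial (Fin 3) R)
        ((X 0 + X 1 * X 2) ^ 2 + X 0 ^ 4 * X 1 ^ 2 * X 2 + X 0 ^ 4 * X 1 ^ 2 * X 2 ^ 6 + X 0 ^ 5 * X 1 ^ 12 * X 2 ^ 6 + X 0 ^ 18 * X 1 ^ 16 * X 2 ^ 8 +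
          X 0 ^ 6 * X 1 ^ 16 * X 2 ^ 8 + X 0 ^ 6 * X 1 ^ 4 * X 2 ^ 8 : MvPolynomial (Fin 3) R) = X 0 ^ 2 := by
  simp only [map_add, map_pow, map_mul, bind₁_X_right]
  simp only [Matrix.cons_val_zero, Matrix.cons_val_one, Matrix.cons_val_two, Matrix.tail_cons, Matrix.head_cons]
  ring

/-! ## Round at `Z₆` (`X₀ ↦ X₀X₁`): the section `Z₇` is OFF `St E₁`, ON `St W` -/

/-- [OURS · L1 W4.5b] `F₃(X₀X₁, X₁, X₂) = X₁² · F₄`, `F₄ = (X₀ + X₂)² + X₁⁴·(…)`. [folklore] -/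
theorem total_Z6 :
    bind₁ (![X 0 * X 1, X 1, X 2] : Fin 3 → MvPolynomial (Fin 3) R)
        ((X 0 + X 1 * X 2) ^ 2 + X 0 ^ 4 * X 1 ^ 2 * X 2 + X 0 ^ 4 * X 1 ^ 2 * X 2 ^ 6 + X 0 ^ 5 * X 1 ^ 12 * X 2 ^ 6 + X 0 ^ 18 * X 1 ^ 16 * X 2 ^ 8 +
          X 0 ^ 6 * X 1 ^ 16 * X 2 ^ 8 + X 0 ^ 6 * X 1 ^ 4 * X 2 ^ 8 : MvPolynomial (Fin 3) R) =
      X 1 ^ 2 * ((X 0 + X 2) ^ 2 + X 1 ^ 4 * (X 0 ^ 4 * X 2 + X 0 ^ 4 * X 2 ^ 6 + X 0 ^ 5 * X 1 ^ 11 * X 2 ^ 6 + X 0 ^ 18 * X 1 ^ 28 * X 2 ^ 8 +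
        X 0 ^ 6 * X 1 ^ 16 * X 2 ^ 8 + X 0 ^ 6 * X 1 ^ 4 * X 2 ^ 8)) := by
  simp only [map_add, map_pow, map_mul, bind₁_X_right]
  simp only [Matrix.cons_val_zero, Matrix.cons_val_one, Matrix.cons_val_two, Matrix.tail_cons, Matrix.head_cons]
  ring

/-- [OURS · L1 W4.5b] `F₄|_{E_{Z₆}} = (X₀ + X₂)²`: the strict transform meets `E_{Z₆} = V(X₁)` in the DOUBLED section `Z₇ = V(X₁, X₀ + X₂)`, the graph `x̄ = −z′`.
[folklore] -/
theorem restrict_EZ6 :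
    bind₁ (![X 0, 0, X 2] : Fin 3 → MvPolynomial (Fin 3) R)
        ((X 0 + X 2) ^ 2 + X 1 ^ 4 * (X 0 ^ 4 * X 2 + X 0 ^ 4 * X 2 ^ 6 + X 0 ^ 5 * X 1 ^ 11 * X 2 ^ 6 + X 0 ^ 18 * X 1 ^ 28 * X 2 ^ 8 +
          X 0 ^ 6 * X 1 ^ 16 * X 2 ^ 8 + X 0 ^ 6 * X 1 ^ 4 * X 2 ^ 8) : MvPolynomial (Fin 3) R) = (X 0 + X 2) ^ 2 := by
  simp only [map_add, map_pow, map_mul, bind₁_X_right]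
  simp only [Matrix.cons_val_zero, Matrix.cons_val_one, Matrix.cons_val_two, Matrix.tail_cons, Matrix.head_cons]
  ring

/-- [OURS · L1 W4.5b] The approximate-root surface through the tower: `W = X₀ + X₁²X₂` becomes `X₁·(X₀ + X₁X₂)` after the `φ′` round and `X₀ + X₁X₂` becomes `X₁·(X₀ + X₂)`
after the `Z₆` round — so `St W = V(X₀ + X₂)` at this stage and `Z₇ = E_{Z₆} ∩ St W`. [folklore] -/
theorem stW_Z6 :
    bind₁ (![X 0 * X 1, X 1, X 2] : Fin 3 → MvPolynomial (Fin 3) R) (X 0 + X 1 ^ 2 * X 2 : MvPolynomial (Fin 3) R) = X 1 * (X 0 + X 1 * X 2) ∧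
    bind₁ (![X 0 * X 1, X 1, X 2] : Fin 3 → MvPolynomial (Fin 3) R) (X 0 + X 1 * X 2 : MvPolynomial (Fin 3) R) = X 1 * (X 0 + X 2) := by
  constructor <;>
  · simp only [map_add, map_pow, map_mul, bind₁_X_right]
    simp only [Matrix.cons_val_zero, Matrix.cons_val_one, Matrix.cons_val_two, Matrix.tail_cons, Matrix.head_cons]
    ring

/-- [OURS · L1 W4.5b] `Z₇` is NOT on `St E₁ = V(X₀)`: the ideal of `Z₇ ∩ St E₁`, `(X₁, X₀ + X₂, X₀)`, contains `X₂` — so the intersection is the single point `z′ = 0`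
(over `P′`), not the curve: no pair with `E₁` presents `Z₇`. [folklore] -/
theorem X2_mem_span_Z7_E1 :
    (X 2 : MvPolynomial (Fin 3) R) ∈ Ideal.span ({X 1, X 0 + X 2, X 0} : Set (MvPolynomial (Fin 3) R)) := by
  have h : (X 2 : MvPolynomial (Fin 3) R) = (X 0 + X 2) - X 0 := by ring
  rw [h]
  exact Ideal.sub_mem _ (Ideal.subset_span (by simp)) (Ideal.subset_span (by simp))

/-- [OURS · L1 W4.5b] `F₄ ∈ (X₁, X₀ + X₂)²`: the strict transform after the two fibre-pair rounds is singular along the curve `Z₇`. [folklore] -/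
theorem mem_sq_Z7 :
    ((X 0 + X 2) ^ 2 + X 1 ^ 4 * (X 0 ^ 4 * X 2 + X 0 ^ 4 * X 2 ^ 6 + X 0 ^ 5 * X 1 ^ 11 * X 2 ^ 6 + X 0 ^ 18 * X 1 ^ 28 * X 2 ^ 8 +
        X 0 ^ 6 * X 1 ^ 16 * X 2 ^ 8 + X 0 ^ 6 * X 1 ^ 4 * X 2 ^ 8) : MvPolynomial (Fin 3) R) ∈
      (Ideal.span {X 1, X 0 + X 2} : Ideal (MvPolynomial (Fin 3) R)) ^ 2 := by
  rw [pow_two (Ideal.span _)]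
  have h1 : (X 1 : MvPolynomial (Fin 3) R) ∈ Ideal.span ({X 1, X 0 + X 2} : Set (MvPolynomial (Fin 3) R)) := Ideal.subset_span (by simp)
  have h02 : (X 0 + X 2 : MvPolynomial (Fin 3) R) ∈ Ideal.span ({X 1, X 0 + X 2} : Set (MvPolynomial (Fin 3) R)) := Ideal.subset_span (by simp)
  refine Ideal.add_mem _ ?_ ?_
  · rw [pow_two]; exact Ideal.mul_mem_mul h02 h02
  · have h4 : (X 1 ^ 4 : MvPolynomial (Fin 3) R) = (X 1 * X 1) * (X 1 * X 1) := by ring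
    rw [h4]
    exact Ideal.mul_mem_right _ _ (Ideal.mul_mem_right _ _ (Ideal.mul_mem_mul h1 h1))

/-! ## Round at `Z₇` (HOSTED; `X₀ + X₂ ↦ X₀X₁`, i.e. `X₀ ↦ X₀X₁ − X₂`): the section `Z₈`, again off `St E₁` -/

/-- [OURS · L1 W4.5b] `F₄(X₀X₁ − X₂, X₁, X₂) = X₁² · F₅`, `F₅ = X₀² + (tail on S := X₀X₁ − X₂)`. [folklore] -/
theorem total_Z7 :
    bind₁ (![X 0 * X 1 - X 2, X 1, X 2] : Fin 3 → MvPolynomial (Fin 3) R)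
        ((X 0 + X 2) ^ 2 + X 1 ^ 4 * (X 0 ^ 4 * X 2 + X 0 ^ 4 * X 2 ^ 6 + X 0 ^ 5 * X 1 ^ 11 * X 2 ^ 6 + X 0 ^ 18 * X 1 ^ 28 * X 2 ^ 8 +
          X 0 ^ 6 * X 1 ^ 16 * X 2 ^ 8 + X 0 ^ 6 * X 1 ^ 4 * X 2 ^ 8) : MvPolynomial (Fin 3) R) =
      X 1 ^ 2 * (X 0 ^ 2 + X 1 ^ 2 * ((X 0 * X 1 - X 2) ^ 4 * X 2 + (X 0 * X 1 - X 2) ^ 4 * X 2 ^ 6 + (X 0 * X 1 - X 2) ^ 5 * X 1 ^ 11 * X 2 ^ 6 +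
        (X 0 * X 1 - X 2) ^ 18 * X 1 ^ 28 * X 2 ^ 8 + (X 0 * X 1 - X 2) ^ 6 * X 1 ^ 16 * X 2 ^ 8 + (X 0 * X 1 - X 2) ^ 6 * X 1 ^ 4 * X 2 ^ 8)) := by
  simp only [map_add, map_pow, map_mul, bind₁_X_right]
  simp only [Matrix.cons_val_zero, Matrix.cons_val_one, Matrix.cons_val_two, Matrix.tail_cons, Matrix.head_cons]
  ring

/-- [OURS · L1 W4.5b] `F₅|_{E_{Z₇}} = X₀²`: the strict transform after the first hosted round meets `E_{Z₇} = V(X₁)` in the DOUBLED section `Z₈ = V(X₀, X₁)` — a SECOND hosted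
round is needed. [folklore] -/
theorem restrict_EZ7 :
    bind₁ (![X 0, 0, X 2] : Fin 3 → MvPolynomial (Fin 3) R)
        (X 0 ^ 2 + X 1 ^ 2 * ((X 0 * X 1 - X 2) ^ 4 * X 2 + (X 0 * X 1 - X 2) ^ 4 * X 2 ^ 6 + (X 0 * X 1 - X 2) ^ 5 * X 1 ^ 11 * X 2 ^ 6 +
          (X 0 * X 1 - X 2) ^ 18 * X 1 ^ 28 * X 2 ^ 8 + (X 0 * X 1 - X 2) ^ 6 * X 1 ^ 16 * X 2 ^ 8 + (X 0 * X 1 - X 2) ^ 6 * X 1 ^ 4 * X 2 ^ 8) : MvPolynomial (Fin 3) R) =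
      X 0 ^ 2 := by
  simp only [map_add, map_pow, map_mul, bind₁_X_right]
  simp only [Matrix.cons_val_zero, Matrix.cons_val_one, Matrix.cons_val_two, Matrix.tail_cons, Matrix.head_cons]
  ring

/-- [OURS · L1 W4.5b] `Z₈ = V(X₀, X₁)` is NOT on `St E₁`: `St E₁` (= `V(X₀)` before this round, not containing the centre `Z₇`) becomes `V(X₀X₁ − X₂)`, whose equation restricts to
`−X₂` on `Z₈` — vanishing only at `z′ = 0` (over `P′`). [folklore] -/
theorem restrict_StE1_Z8 :
    bind₁ (![0, 0, X 2] : Fin 3 → MvPolynomial (Fin 3) R) (X 0 * X 1 - X 2 : MvPolynomial (Fin 3) R) = -X 2 := by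
  simp only [map_sub, map_mul, bind₁_X_right]
  simp only [Matrix.cons_val_zero, Matrix.cons_val_one, Matrix.cons_val_two, Matrix.tail_cons, Matrix.head_cons]
  ring

/-- [OURS · L1 W4.5b] `F₅ ∈ (X₀, X₁)²`: singular along `Z₈`. [folklore] -/
theorem mem_sq_Z8 :
    (X 0 ^ 2 + X 1 ^ 2 * ((X 0 * X 1 - X 2) ^ 4 * X 2 + (X 0 * X 1 - X 2) ^ 4 * X 2 ^ 6 + (X 0 * X 1 - X 2) ^ 5 * X 1 ^ 11 * X 2 ^ 6 +
        (X 0 * X 1 - X 2) ^ 18 * X 1 ^ 28 * X 2 ^ 8 + (X 0 * X 1 - X 2) ^ 6 * X 1 ^ 16 * X 2 ^ 8 + (X 0 * X 1 - X 2) ^ 6 * X 1 ^ 4 * X 2 ^ 8) : MvPolynomial (Fin 3) R) ∈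
      (Ideal.span {X 0, X 1} : Ideal (MvPolynomial (Fin 3) R)) ^ 2 := by
  rw [pow_two (Ideal.span _)]
  have h0 : (X 0 : MvPolynomial (Fin 3) R) ∈ Ideal.span ({X 0, X 1} : Set (MvPolynomial (Fin 3) R)) := Ideal.subset_span (by simp)
  have h1 : (X 1 : MvPolynomial (Fin 3) R) ∈ Ideal.span ({X 0, X 1} : Set (MvPolynomial (Fin 3) R)) := Ideal.subset_span (by simp)
  refine Ideal.add_mem _ ?_ ?_
  · rw [pow_two]; exact Ideal.mul_mem_mul h0 h0
  · rw [pow_two]; exact Ideal.mul_mem_right _ _ (Ideal.mul_mem_mul h1 h1)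

/-! ## Round at `Z₈` (HOSTED; `X₀ ↦ X₀X₁`): the tower ends -/

/-- [OURS · L1 W4.5b] `F₅(X₀X₁, X₁, X₂) = X₁² · F₆` and `F₆|_{E_{Z₈}} = X₀² + X₂⁵ + X₂¹⁰` — a REDUCED curve: no further singular section (a cusp point over `P′` is left as a leaf).
[folklore] -/
theorem total_Z8_restrict :
    bind₁ (![X 0 * X 1, X 1, X 2] : Fin 3 → MvPolynomial (Fin 3) R)
        (X 0 ^ 2 + X 1 ^ 2 * ((X 0 * X 1 - X 2) ^ 4 * X 2 + (X 0 * X 1 - X 2) ^ 4 * X 2 ^ 6 + (X 0 * X 1 - X 2) ^ 5 * X 1 ^ 11 * X 2 ^ 6 +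
          (X 0 * X 1 - X 2) ^ 18 * X 1 ^ 28 * X 2 ^ 8 + (X 0 * X 1 - X 2) ^ 6 * X 1 ^ 16 * X 2 ^ 8 + (X 0 * X 1 - X 2) ^ 6 * X 1 ^ 4 * X 2 ^ 8) : MvPolynomial (Fin 3) R) =
      X 1 ^ 2 * (X 0 ^ 2 + ((X 0 * X 1 ^ 2 - X 2) ^ 4 * X 2 + (X 0 * X 1 ^ 2 - X 2) ^ 4 * X 2 ^ 6 + (X 0 * X 1 ^ 2 - X 2) ^ 5 * X 1 ^ 11 * X 2 ^ 6 +
        (X 0 * X 1 ^ 2 - X 2) ^ 18 * X 1 ^ 28 * X 2 ^ 8 + (X 0 * X 1 ^ 2 - X 2) ^ 6 * X 1 ^ 16 * X 2 ^ 8 + (X 0 * X 1 ^ 2 - X 2) ^ 6 * X 1 ^ 4 * X 2 ^ 8)) ∧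
    bind₁ (![X 0, 0, X 2] : Fin 3 → MvPolynomial (Fin 3) R)
        (X 0 ^ 2 + ((X 0 * X 1 ^ 2 - X 2) ^ 4 * X 2 + (X 0 * X 1 ^ 2 - X 2) ^ 4 * X 2 ^ 6 + (X 0 * X 1 ^ 2 - X 2) ^ 5 * X 1 ^ 11 * X 2 ^ 6 +
          (X 0 * X 1 ^ 2 - X 2) ^ 18 * X 1 ^ 28 * X 2 ^ 8 + (X 0 * X 1 ^ 2 - X 2) ^ 6 * X 1 ^ 16 * X 2 ^ 8 + (X 0 * X 1 ^ 2 - X 2) ^ 6 * X 1 ^ 4 * X 2 ^ 8) : MvPolynomial (Fin 3) R) =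
      X 0 ^ 2 + X 2 ^ 5 + X 2 ^ 10 := by
  constructor
  · simp only [map_add, map_sub, map_pow, map_mul, bind₁_X_right]
    simp only [Matrix.cons_val_zero, Matrix.cons_val_one, Matrix.cons_val_two, Matrix.tail_cons, Matrix.head_cons]
    ring
  · simp only [map_add, map_sub, map_pow, map_mul, bind₁_X_right]
    simp only [Matrix.cons_val_zero, Matrix.cons_val_one, Matrix.cons_val_two, Matrix.tail_cons, Matrix.head_cons]
    ring

end SpecimenN10

end Summit.ResolutionOfSingularities.ResolutionOfSingularities.Cruxes.EquisingularLiftNat.Sections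

end
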